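import Literature.Analysis.Distribution.Hypoelliptic
import HarnessLib

/-!
# Stub `stub_flipSteadyState_hasSmoothDensity` of line `sector-dirichlet-gluing`, part 1:
conjugating Hörmander data by a continuous linear equivalence

Helper file `--supports stmt-AtomisticToContinuum-11977` (crux `VanishingNoiseTransfer.NoisyFourier`,
route `VanishingNoiseTransfer`, line `sector-dirichlet-gluing`, stub
`stub_flipSteadyState_hasSmoothDensity`).

General bookkeeping on two real normed spaces `E`, `F` and a continuous linear equivalence
`A : E ≃L[ℝ] F` (no inner product, no measure): the pushforward `A_* V = A ∘ V ∘ A⁻¹` of a vector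
field (written as the lambda `fun y => A (V (A.symm y))` throughout, no definition is introduced)
is compatible with

* derivatives (`fderiv_conj_apply`), Hörmander's first-order operators
  (`fieldDeriv_comp_equiv`), divergences (`fieldDiv_conj`) and formal
  transposes (`fieldTranspose_comp_equiv`, `hormanderTranspose_comp_equiv`:
  `ᵗP (f ∘ A) = (ᵗP^A f) ∘ A` where `P^A` has the pushed-forward fields and the coefficient
  `c ∘ A⁻¹`);
* Lie brackets (`lieBracket_conj`, unconditionally), iterated brackets
  (`isIteratedLieBracket_conj`) and Hörmander's bracket condition
  (`isBracketGenerating_conj`);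
* smoothness (`contDiff_conj`).

This is the transport needed to write the velocity-flip conjugates `Θ_S L* Θ_S` of the
Fokker–Planck operator of an oscillator chain again in Hörmander's form `∑ X_j² + X₀ + c`
(the `Θ_S` are linear isometric involutions of phase space, which carries the sup norm, so the
inner-product version `Literature.Analysis.Hypoelliptic.push` does not apply verbatim).
-/

noncomputable section

open Set Function
open scoped ContDiff

namespace Summit.AtomisticToContinuum.FouriersLaw.Cruxes.NoisyFourier.SectorDirichletGluing

open Literature.Analysis.Distribution

variable {E F : Type*} [NormedAddCommGroup E] [NormedSpace ℝ E] [NormedAddCommGroup F]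
  [NormedSpace ℝ F]

/-- The derivative of the pushforward `A ∘ V ∘ A⁻¹` of a vector field along a continuous linear
equivalence: `D(A V A⁻¹)(y) v = A (DV(A⁻¹y) (A⁻¹ v))` (no differentiability needed: both sides
vanish where `V` is not differentiable). [folklore] -/
theorem fderiv_conj_apply (A : E ≃L[ℝ] F) (V : E → E) (y v : F) :
    fderiv ℝ (fun y => A (V (A.symm y))) y v = A (fderiv ℝ V (A.symm y) (A.symm v)) := by
  have h1 : (fun y => A (V (A.symm y))) = A ∘ (V ∘ A.symm) := rfl
  rw [h1, A.comp_fderiv, A.symm.comp_right_fderiv]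
  rfl

/-- `X (f ∘ A) = ((A_* X) f) ∘ A` for Hörmander's first-order operator of a vector field. [folklore] -/
theorem fieldDeriv_comp_equiv (A : E ≃L[ℝ] F) (V : E → E) (f : F → ℝ) (x : E) :
    fieldDeriv V (f ∘ A) x = fieldDeriv (fun y => A (V (A.symm y))) f (A x) := by
  simp only [fieldDeriv_apply]
  rw [A.comp_right_fderiv, ContinuousLinearMap.comp_apply, ContinuousLinearEquiv.coe_coe,
    A.symm_apply_apply]

/-- The pushforward of a smooth vector field is smooth. [folklore] -/
theorem contDiff_conj (A : E ≃L[ℝ] F) {V : E → E} (hV : ContDiff ℝ ∞ V) :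
    ContDiff ℝ ∞ (fun y => A (V (A.symm y))) :=
  A.contDiff.comp (hV.comp A.symm.contDiff)

/-- **Lie brackets are natural under continuous linear equivalences**:
`[A_* V, A_* W] = A_* [V, W]` (unconditionally, with Mathlib's junk values). [folklore] -/
theorem lieBracket_conj (A : E ≃L[ℝ] F) (V W : E → E) :
    VectorField.lieBracket ℝ (fun y => A (V (A.symm y))) (fun y => A (W (A.symm y))) =
      fun y => A (VectorField.lieBracket ℝ V W (A.symm y)) := by
  funext y
  simp only [VectorField.lieBracket_eq]
  rw [fderiv_conj_apply, fderiv_conj_apply, A.symm_apply_apply, A.symm_apply_apply, map_sub]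

/-- Iterated brackets of the pushed-forward family are the pushforwards of the iterated brackets.
[folklore] -/
theorem isIteratedLieBracket_conj {κ : Type*} (A : E ≃L[ℝ] F) (Y : κ → E → E) {V : E → E}
    (hV : IsIteratedLieBracket Y V) :
    IsIteratedLieBracket (fun k y => A (Y k (A.symm y))) (fun y => A (V (A.symm y))) := by
  induction hV with
  | of i => exact IsIteratedLieBracket.of (X := fun k y => A (Y k (A.symm y))) i
  | lieBracket i hW ih =>
    rename_i W
    have h := IsIteratedLieBracket.lieBracket (X := fun k y => A (Y k (A.symm y))) i ih
    have e : VectorField.lieBracket ℝ ((fun k y => A (Y k (A.symm y))) i)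
        (fun y => A (W (A.symm y))) = fun y => A (VectorField.lieBracket ℝ (Y i) W (A.symm y)) :=
      lieBracket_conj A (Y i) W
    rwa [e] at h

/-- **Hörmander's bracket condition is transported by continuous linear equivalences**: if the
family `Y` is bracket-generating on `s`, the pushed-forward family `A_* Y` is bracket-generating
on `A(s) = A.symm ⁻¹' s` (the span of the bracket values at `y` contains the image under `A` of
the span at `A⁻¹ y`). [folklore] -/
theorem isBracketGenerating_conj {κ : Type*} (A : E ≃L[ℝ] F) {Y : κ → E → E} {s : Set E}
    (h : IsBracketGenerating Y s) :
    IsBracketGenerating (fun k y => A (Y k (A.symm y))) (A.symm ⁻¹' s) := by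
  intro y hy
  have hx := h (A.symm y) hy
  have hsub : ((A : E →ₗ[ℝ] F) : E → F) ''
      {v : E | ∃ V : E → E, IsIteratedLieBracket Y V ∧ V (A.symm y) = v} ⊆
      {v : F | ∃ V : F → F, IsIteratedLieBracket (fun k y => A (Y k (A.symm y))) V ∧ V y = v} := by
    rintro _ ⟨v, ⟨V, hV, rfl⟩, rfl⟩
    exact ⟨_, isIteratedLieBracket_conj A Y hV, rfl⟩
  rw [eq_top_iff]
  calc (⊤ : Submodule ℝ F) = Submodule.map (A : E →ₗ[ℝ] F) ⊤ := by
        rw [Submodule.map_top, LinearMap.range_eq_top.2 A.surjective]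
    _ = Submodule.span ℝ (((A : E →ₗ[ℝ] F) : E → F) ''
          {v : E | ∃ V : E → E, IsIteratedLieBracket Y V ∧ V (A.symm y) = v}) := by
        rw [Submodule.span_image, hx]
    _ ≤ _ := Submodule.span_mono hsub

/-- The bracket condition on the whole space is transported by continuous linear equivalences.
[folklore] -/
theorem isBracketGenerating_conj_univ {κ : Type*} (A : E ≃L[ℝ] F) {Y : κ → E → E}
    (h : IsBracketGenerating Y univ) :
    IsBracketGenerating (fun k y => A (Y k (A.symm y))) univ := by
  simpa using isBracketGenerating_conj A h

/-- The bracket condition for Hörmander data `(X₀, X)` indexed by `Option ι` is transported by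
continuous linear equivalences. [folklore] -/
theorem isBracketGenerating_elim_conj {ι : Type*} (A : E ≃L[ℝ] F) {X₀ : E → E} {X : ι → E → E}
    (h : IsBracketGenerating (fun o : Option ι => o.elim X₀ X) univ) :
    IsBracketGenerating (fun o : Option ι => o.elim (fun y => A (X₀ (A.symm y)))
      (fun j y => A (X j (A.symm y)))) univ := by
  have e : (fun o : Option ι => o.elim (fun y => A (X₀ (A.symm y))) (fun j y => A (X j (A.symm y)))) =
      fun o y => A ((o.elim X₀ X : E → E) (A.symm y)) := by
    funext o y
    cases o <;> rfl
  rw [e]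
  exact isBracketGenerating_conj_univ A h

/-- **Divergences are invariant under linear changes of variables**:
`div (A_* V) (y) = div V (A⁻¹ y)` (the trace is conjugation invariant; with Mathlib's junk value
`0` of the trace in infinite dimension no finiteness assumption is needed). [folklore] -/
theorem fieldDiv_conj (A : E ≃L[ℝ] F) (V : E → E) (y : F) :
    fieldDiv (fun y => A (V (A.symm y))) y = fieldDiv V (A.symm y) := by
  unfold fieldDiv
  have h1 : (fun y => A (V (A.symm y))) = A ∘ (V ∘ A.symm) := rfl
  rw [h1, A.comp_fderiv, A.symm.comp_right_fderiv]
  have h2 : (((A : E →L[ℝ] F).comp ((fderiv ℝ V (A.symm y)).comp (A.symm : F →L[ℝ] E)) :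
      F →L[ℝ] F) : F →ₗ[ℝ] F) =
      (A.toLinearEquiv : E ≃ₗ[ℝ] F).conj (fderiv ℝ V (A.symm y) : E →ₗ[ℝ] E) := by
    rw [LinearEquiv.conj_apply]
    rfl
  rw [h2, LinearMap.trace_conj']

/-- **`ᵗX (f ∘ A) = (ᵗ(A_* X) f) ∘ A`** for the formal transpose of a vector field. [folklore] -/
theorem fieldTranspose_comp_equiv (A : E ≃L[ℝ] F) (V : E → E) (f : F → ℝ) (x : E) :
    fieldTranspose V (f ∘ A) x = fieldTranspose (fun y => A (V (A.symm y))) f (A x) := by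
  simp only [fieldTranspose, fieldDeriv_comp_equiv A V f x, fieldDiv_conj A V (A x),
    A.symm_apply_apply, Function.comp_apply]

/-- Function-level form of `fieldTranspose_comp_equiv`. [folklore] -/
theorem fieldTranspose_comp_equiv' (A : E ≃L[ℝ] F) (V : E → E) (f : F → ℝ) :
    fieldTranspose V (f ∘ A) = fieldTranspose (fun y => A (V (A.symm y))) f ∘ A :=
  funext (fieldTranspose_comp_equiv A V f)

/-- **`ᵗP (f ∘ A) = (ᵗP^A f) ∘ A`**: the formal transpose of Hörmander's operator
`P = ∑ X_j² + X₀ + c` on `f ∘ A` is the formal transpose of the pushed-forward operator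
`P^A = ∑ (A_*X_j)² + A_*X₀ + c ∘ A⁻¹` on `f`, evaluated at `A x`. [folklore] -/
theorem hormanderTranspose_comp_equiv {ι : Type*} [Fintype ι] (A : E ≃L[ℝ] F) (X₀ : E → E)
    (X : ι → E → E) (c : E → ℝ) (f : F → ℝ) (x : E) :
    hormanderTranspose X₀ X c (f ∘ A) x =
      hormanderTranspose (fun y => A (X₀ (A.symm y))) (fun j y => A (X j (A.symm y)))
        (c ∘ A.symm) f (A x) := by
  simp only [hormanderTranspose, fieldTranspose_comp_equiv', Function.comp_apply,
    A.symm_apply_apply]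

/-- `hormanderTranspose_comp_equiv` read at `y = A x`:
`ᵗP^A f (y) = ᵗP (f ∘ A) (A⁻¹ y)`. [folklore] -/
theorem hormanderTranspose_conj_apply {ι : Type*} [Fintype ι] (A : E ≃L[ℝ] F) (X₀ : E → E)
    (X : ι → E → E) (c : E → ℝ) (f : F → ℝ) (y : F) :
    hormanderTranspose (fun y => A (X₀ (A.symm y))) (fun j y => A (X j (A.symm y)))
        (c ∘ A.symm) f y = hormanderTranspose X₀ X c (f ∘ A) (A.symm y) := by
  rw [hormanderTranspose_comp_equiv, A.apply_symm_apply]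

/-- **Registered helper sub-goal of stub `stub_flipSteadyState_hasSmoothDensity`** (the
transport statement in closed form, one universe): for a continuous linear automorphism `A` of a
real normed space `E` and Hörmander data `(X₀, X, c)`,
`ᵗP (f ∘ A) (x) = ᵗP^A f (A x)` with `P^A = ∑ (A_*X_j)² + A_*X₀ + c ∘ A⁻¹`. [folklore] -/
theorem helper_hasSmoothDensity_hormanderTransposeConj : ∀ (E : Type) [NormedAddCommGroup E] [NormedSpace ℝ E] (ι : Type) [Fintype ι] (A : E ≃L[ℝ] E) (X₀ : E → E) (X : ι → E → E) (c : E → ℝ) (f : E → ℝ) (x : E), Literature.Analysis.Distribution.hormanderTranspose X₀ X c (f ∘ A) x = Literature.Analysis.Distribution.hormanderTranspose (fun y => A (X₀ (A.symm y))) (fun j y => A (X j (A.symm y))) (c ∘ A.symm) f (A x) :=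
  fun _ _ _ _ _ A X₀ X c f x => hormanderTranspose_comp_equiv A X₀ X c f x

end Summit.AtomisticToContinuum.FouriersLaw.Cruxes.NoisyFourier.SectorDirichletGluing
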